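import Summits.CriticalPhenomena.PercolationContinuityZ3.Theorems.PercNearOneGluingNoHeavyLowerTailSahiThreeCopyPairsClosure
import Summits.CriticalPhenomena.PercolationContinuityZ3.Theorems.PercNearOneGluingNoHeavyLowerTailSahiThreeCopyLiterals
import Summits.CriticalPhenomena.PercolationContinuityZ3.Theorems.PercNearOneGluingNoHeavyLowerTailSahiThreeCopySlices
import Summits.CriticalPhenomena.PercolationContinuityZ3.Theorems.PercNearOneGluingNoHeavyLowerTailSahiThreeCopyGadget

/-!
# `NoHeavyLowerTail` (crux stmt-CriticalPhenomena-4575), Sahi programme: **UNIVERSALLY GOOD PAIRS ARE CLOSED UNDER AND-ADJOINING A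
# FRESH LITERAL TO ONE OR BOTH MEMBERS** — `UG(f,g) ⇒ UG(f ∧_{c₁} x₀, g ∧_{c₂} x₀)` for all `c₁, c₂`, third function FREE

Support file (Sahi cell, seat `prim-sahi-p1`, generation 55; `--supports stmt-CriticalPhenomena-4575`).  COMPUTATIONAL only through the
import of `…PairsClosure` (base `≤ 4` of `UGen`); the theorems of this file use standard axioms.  Vocabulary: `andAdj c f` of `…Literals`, `N3_zero_mid'` of `…Gadget`
(generation 54: `f ∧_c x₀`, `c = false` = `f` lifted), `UGood` of `…Pairs`.

Unlike `…Literals` / `…MixedLiterals` (generation 54), where the literal is adjoined to all THREE slots of a good triple, here the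
third function `H` is an ARBITRARY nonnegative monotone function of `(x₀, x)`; the price is the universal-goodness hypothesis on the pair.
By the slice formulas `tc_cons_one/two` the four profile entries at the new coordinate give (`H⁰ ≤ H¹` the sections of `H`):
* both members (`c₁ = c₂ = true`): `k=1`: `2N(fgH¹;1;1) − N(fg;H⁰;1) ≥ N(fgH¹;1;1) ≥ 0`; `k=2`:
  `c(f,g,H¹) + 2N(fgH¹;1;1) − N(fg;H⁰;1) − [N(f;g;H¹) − N(f;g;H⁰)] ≥ c(f,g,H¹) + N(f;g;H⁰) ≥ 0` (three-copy Harris twice);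
* one member (`c₁ = false, c₂ = true`): `k=1`: `c(f,g,H⁰) + 2N(fg(H¹−H⁰);1;1) − N(f;g(H¹−H⁰);1) ≥ c(f,g,H¹) ≥ 0` (the difference is
  `N(g;f(H¹−H⁰);1) + N(fg;1;H¹−H⁰) − N(f;g;H¹−H⁰) ≥ 0`, Harris with the spectator `H¹ − H⁰ ≥ 0`); `k=2`: `c(f,g,H¹) +` the same;
* `k = 0, 3`: sections.  Hence `UGood.andAdj` and the `UGen`-level corollary `UGen.andAdj_uGood`: e.g. `(σ₅ ∧ Φ_A(σ₁..σ₄), Φ_B(σ₁..σ₄))`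
  and `(σ₅ ∧ Φ_A, σ₅ ∧ Φ_B)` with a FIFTH block event are universally good (beyond the four-event algebra of `…PairsClosure`).
Nothing conjectural is used.  [this work]
-/

namespace Summit.CriticalPhenomena.PercolationContinuityZ3.Theorems.SahiThreeCopy

open Finset Function Literature.Combinatorics.Sahi2008
open scoped BigOperators

noncomputable section

variable {d : ℕ}

/-! ### §1 Sections of AND-adjoined functions and small vanishing lemmas -/

/-- `(f ∧ x₀)¹ = f`. [this work] -/
theorem sec_andAdj_true_true (f : Pt d → ℝ) : sec (andAdj true f) true = f := by
  funext x; simp [sec, andAdj, Fin.cons_zero]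

/-- `(f ∧ x₀)⁰ = 0`. [this work] -/
theorem sec_andAdj_true_false (f : Pt d → ℝ) : sec (andAdj true f) false = 0 := by
  funext x; simp [sec, andAdj, Fin.cons_zero]

/-- `(f ∧_{false} x₀)^ε = f` (the lifted function). [this work] -/
theorem sec_andAdj_false (f : Pt d → ℝ) (ε : Bool) : sec (andAdj false f) ε = f := by
  funext x; simp [sec, andAdj, Fin.tail_cons]

/-- `c_b(f, 0, h) = 0`. [this work] -/
theorem tc_zero_mid (b : Fin d → ℕ) (f h : Pt d → ℝ) : tc b f 0 h = 0 := by
  rw [tc_comm12, tc_zero_left]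

/-- `c_b(f, g, 0) = 0`. [this work] -/
theorem tc_zero_right (b : Fin d → ℕ) (f g : Pt d → ℝ) : tc b f g 0 = 0 := by
  rw [tc_comm13, tc_zero_left]

/-! ### §2 Both members: `(f ∧ x₀, g ∧ x₀)` against a free `H` -/

/-- ★ The pair `(f ∧ x₀, g ∧ x₀)` against a free third function, all profiles (given `c_{b}(f,g,H¹) ≥ 0` and `f, g, H` nonnegative
monotone). [this work] -/
theorem tc_andAdj_both_nonneg (b : Fin (d + 1) → ℕ) {f g : Pt d → ℝ} (hf : ∀ x, 0 ≤ f x) (hfm : Monotone f) (hg : ∀ x, 0 ≤ g x)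
    (hgm : Monotone g) {H : Pt (d + 1) → ℝ} (hH : ∀ w, 0 ≤ H w) (hHm : Monotone H)
    (hfg : 0 ≤ tc (Fin.tail b) f g (sec H true)) : 0 ≤ tc b (andAdj true f) (andAdj true g) H := by
  have hb : b = Fin.cons (b 0) (Fin.tail b) := (Fin.cons_self_tail b).symm
  set b' := Fin.tail b
  have hH0n : ∀ x, 0 ≤ (sec H false) x := sec_nonneg hH false
  have hH1n : ∀ x, 0 ≤ (sec H true) x := sec_nonneg hH true
  have hH0m : Monotone (sec H false) := sec_monotone hHm false
  have hH1m : Monotone (sec H true) := sec_monotone hHm true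
  have h01 : ∀ x, (sec H false) x ≤ (sec H true) x := sec_false_le_sec_true hHm
  have hfg0 : ∀ x, 0 ≤ (f * g) x := fun x => mul_nonneg (hf x) (hg x)
  have hfgm : Monotone (f * g) := hfm.mul hgm hf hg
  have one_nn : ∀ x : Pt d, (0 : ℝ) ≤ (1 : Pt d → ℝ) x := fun _ => zero_le_one
  -- Harris facts
  have F1 : N3 b' (f * g) (sec H false) 1 ≤ N3 b' (f * g * (sec H false)) 1 1 := N3_le_N3_mul d b' (f * g) (sec H false) 1 hfg0 hfgm hH0n hH0m one_nn
  have F2 : N3 b' (f * g * (sec H false)) 1 1 ≤ N3 b' (f * g * (sec H true)) 1 1 :=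
    N3_mono_left b' (fun x => mul_le_mul_of_nonneg_left (h01 x) (hfg0 x)) one_nn one_nn
  have F3 : N3 b' f g (sec H true) ≤ N3 b' (f * g) 1 (sec H true) := N3_le_N3_mul d b' f g (sec H true) hf hfm hg hgm hH1n
  have F4 : N3 b' (f * g) (sec H true) 1 ≤ N3 b' (f * g * (sec H true)) 1 1 := N3_le_N3_mul d b' (f * g) (sec H true) 1 hfg0 hfgm hH1n hH1m one_nn
  have F5 : N3 b' (f * g) 1 (sec H true) = N3 b' (f * g) (sec H true) 1 := N3_comm23 b' (f * g) 1 (sec H true)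
  have F6 : 0 ≤ N3 b' f g (sec H false) := N3_nonneg b' hf hg hH0n
  have F7 : 0 ≤ N3 b' (f * g * (sec H true)) 1 1 := N3_nonneg b' (fun x => mul_nonneg (hfg0 x) (hH1n x)) one_nn one_nn
  rw [hb]
  match hk : b 0 with
  | 0 =>
    rw [tc_cons_zero, sec_andAdj_true_false, tc_zero_left]
  | 1 =>
    rw [tc_cons_one]
    simp only [sec_andAdj_true_true, sec_andAdj_true_false, sub_zero, zero_mul, mul_zero, N3_zero_left,
      tc_zero_left, tc_zero_mid, zero_add, add_zero, sub_self]
    -- remaining: 2N(fgH⁰;1;1) − N(H⁰;fg;1) + 2N(fg(H¹−H⁰);1;1)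
    have e1 : N3 b' (f * g * ((sec H true) - (sec H false))) 1 1 = N3 b' (f * g * (sec H true)) 1 1 - N3 b' (f * g * (sec H false)) 1 1 := by
      rw [mul_sub, N3_sub_left]
    have e2 : N3 b' (sec H false) (f * g) 1 = N3 b' (f * g) (sec H false) 1 := N3_comm12 b' (sec H false) (f * g) 1
    rw [e1, e2]
    linarith
  | 2 =>
    rw [tc_cons_two]
    simp only [sec_andAdj_true_true, sec_andAdj_true_false, sub_zero, zero_mul, mul_zero, N3_zero_left,
      tc_zero_left, tc_zero_mid, zero_add, add_zero, sub_self]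
    have e1 : N3 b' (f * g * ((sec H true) - (sec H false))) 1 1 = N3 b' (f * g * (sec H true)) 1 1 - N3 b' (f * g * (sec H false)) 1 1 := by
      rw [mul_sub, N3_sub_left]
    have e2 : N3 b' (sec H false) (f * g) 1 = N3 b' (f * g) (sec H false) 1 := N3_comm12 b' (sec H false) (f * g) 1
    have e3 : N3 b' f (g * ((sec H true) - (sec H false))) 1 = N3 b' f (g * (sec H true)) 1 - N3 b' f (g * (sec H false)) 1 := by rw [mul_sub, N3_sub_mid]
    have e4 : N3 b' g (f * ((sec H true) - (sec H false))) 1 = N3 b' g (f * (sec H true)) 1 - N3 b' g (f * (sec H false)) 1 := by rw [mul_sub, N3_sub_mid]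
    have e5 : N3 b' ((sec H true) - (sec H false)) (f * g) 1 = N3 b' (f * g) (sec H true) 1 - N3 b' (f * g) (sec H false) 1 := by
      rw [N3_sub_left, N3_comm12 b' (sec H true) (f * g) 1, N3_comm12 b' (sec H false) (f * g) 1]
    -- the known-sign combination `c(f,g,H¹)` and `c(f,g,H⁰)`
    have t1 := hfg
    have t0 : tc b' f g (sec H false) = 2 * N3 b' (f * g * (sec H false)) 1 1 - (N3 b' f (g * (sec H false)) 1 + N3 b' g (f * (sec H false)) 1 + N3 b' (sec H false) (f * g) 1) +
        N3 b' f g (sec H false) := rfl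
    unfold tc at t1
    rw [N3_comm12 b' (sec H true) (f * g) 1] at t1
    rw [e1, e3, e4, e5, t0, e2]
    nlinarith [F1, F2, F3, F4, F5, F6, F7, h01]
  | 3 =>
    rw [tc_cons_three, sec_andAdj_true_true, sec_andAdj_true_true]
    exact hfg
  | k + 4 =>
    rw [tc_cons_add_four]

/-! ### §3 One member: `(f, g ∧ x₀)` against a free `H` -/

/-- ★ The pair `(f, g ∧ x₀)` (`f` lifted) against a free third function, all profiles (given `c_b(f,g,H¹) ≥ 0`). [this work] -/
theorem tc_andAdj_right_nonneg (b : Fin (d + 1) → ℕ) {f g : Pt d → ℝ} (hf : ∀ x, 0 ≤ f x) (hfm : Monotone f) (hg : ∀ x, 0 ≤ g x)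
    (hgm : Monotone g) {H : Pt (d + 1) → ℝ} (hH : ∀ w, 0 ≤ H w) (hHm : Monotone H)
    (hfg : 0 ≤ tc (Fin.tail b) f g (sec H true)) : 0 ≤ tc b (andAdj false f) (andAdj true g) H := by
  have hb : b = Fin.cons (b 0) (Fin.tail b) := (Fin.cons_self_tail b).symm
  set b' := Fin.tail b
  have hH0n : ∀ x, 0 ≤ (sec H false) x := sec_nonneg hH false
  have hH1n : ∀ x, 0 ≤ (sec H true) x := sec_nonneg hH true
  have h01 : ∀ x, (sec H false) x ≤ (sec H true) x := sec_false_le_sec_true hHm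
  have hδ : ∀ x, 0 ≤ ((sec H true) - (sec H false)) x := fun x => sub_nonneg.2 (h01 x)
  -- Harris with the spectator `H¹ − H⁰ ≥ 0`, and a nonnegative cross term
  have F1 : N3 b' f g ((sec H true) - (sec H false)) ≤ N3 b' (f * g) 1 ((sec H true) - (sec H false)) := N3_le_N3_mul d b' f g ((sec H true) - (sec H false)) hf hfm hg hgm hδ
  have F2 : 0 ≤ N3 b' g (f * ((sec H true) - (sec H false))) 1 :=
    N3_nonneg b' hg (fun x => mul_nonneg (hf x) (hδ x)) fun _ => zero_le_one
  have F3 : N3 b' (f * g) 1 ((sec H true) - (sec H false)) = N3 b' ((sec H true) - (sec H false)) (f * g) 1 := by rw [N3_comm13, N3_comm23]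
  rw [hb]
  match hk : b 0 with
  | 0 =>
    rw [tc_cons_zero, sec_andAdj_true_false, tc_zero_mid]
  | 1 =>
    rw [tc_cons_one]
    simp only [sec_andAdj_true_true, sec_andAdj_true_false, sec_andAdj_false, sub_zero, sub_self, zero_mul, mul_zero,
      N3_zero_left, N3_zero_mid', tc_zero_mid, zero_add, add_zero]
    -- goal: 0 ≤ c(f,g,H⁰) + (2N(f g (H¹−H⁰);1;1) − N(f; g(H¹−H⁰); 1)); compare with c(f,g,H¹)
    have key : tc b' f g (sec H false) + (2 * N3 b' (f * g * ((sec H true) - (sec H false))) 1 1 - N3 b' f (g * ((sec H true) - (sec H false))) 1) =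
        tc b' f g (sec H true) + (N3 b' g (f * ((sec H true) - (sec H false))) 1 + N3 b' ((sec H true) - (sec H false)) (f * g) 1 - N3 b' f g ((sec H true) - (sec H false))) := by
      unfold tc
      simp only [mul_sub, N3_sub_left, N3_sub_mid, N3_sub_right]
      ring
    rw [key]
    linarith [F1, F2, F3, hfg]
  | 2 =>
    rw [tc_cons_two]
    simp only [sec_andAdj_true_true, sec_andAdj_true_false, sec_andAdj_false, sub_zero, sub_self, zero_mul, mul_zero,
      N3_zero_left, N3_zero_mid', tc_zero_mid, add_zero]
    have key : tc b' f g (sec H false) + (2 * N3 b' (f * g * ((sec H true) - (sec H false))) 1 1 - N3 b' f (g * ((sec H true) - (sec H false))) 1) =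
        tc b' f g (sec H true) + (N3 b' g (f * ((sec H true) - (sec H false))) 1 + N3 b' ((sec H true) - (sec H false)) (f * g) 1 - N3 b' f g ((sec H true) - (sec H false))) := by
      unfold tc
      simp only [mul_sub, N3_sub_left, N3_sub_mid, N3_sub_right]
      ring
    linarith [F1, F2, F3, hfg, key]
  | 3 =>
    rw [tc_cons_three, sec_andAdj_true_true, sec_andAdj_false]
    exact hfg
  | k + 4 =>
    rw [tc_cons_add_four]

/-! ### §4 Universally good pairs and literals -/

/-- ★★ **Universally good pairs are closed under AND-adjoining a fresh literal to one or both members** (third function free). [this work] -/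
theorem UGood.andAdj {f g : Pt d → ℝ} (h : UGood f g) (c₁ c₂ : Bool) :
    UGood (SahiThreeCopy.andAdj c₁ f) (SahiThreeCopy.andAdj c₂ g) := by
  obtain ⟨hf, hg, hfm, hgm, htc⟩ := h
  refine ⟨andAdj_nonneg c₁ hf, andAdj_nonneg c₂ hg, andAdj_monotone c₁ hf hfm, andAdj_monotone c₂ hg hgm, fun b H hH hHm => ?_⟩
  have hfg : 0 ≤ tc (Fin.tail b) f g (sec H true) := htc _ _ (sec_nonneg hH true) (sec_monotone hHm true)
  have hgf : 0 ≤ tc (Fin.tail b) g f (sec H true) := by rw [tc_comm12]; exact hfg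
  cases c₁ <;> cases c₂
  · -- both lifted: `andAdj false f = liftB 1 f`
    have e1 : SahiThreeCopy.andAdj false f = SahiThreeCopy.liftB 1 f := by funext w; simp [SahiThreeCopy.andAdj, SahiThreeCopy.liftB]
    have e2 : SahiThreeCopy.andAdj false g = SahiThreeCopy.liftB 1 g := by funext w; simp [SahiThreeCopy.andAdj, SahiThreeCopy.liftB]
    rw [e1, e2]
    have hug : UGood f g := ⟨hf, hg, hfm, hgm, htc⟩
    exact (hug.liftB 1).2.2.2.2 b H hH hHm
  · exact tc_andAdj_right_nonneg b hf hfm hg hgm hH hHm hfg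
  · rw [tc_comm12]; exact tc_andAdj_right_nonneg b hg hgm hf hfm hH hHm hgf
  · exact tc_andAdj_both_nonneg b hf hfm hg hgm hH hHm hfg

/-- Hence every pair of the generated class `UGen` stays universally good after AND-adjoining fresh literals (and, by `UGood.subst`,
after substituting those literals by arbitrary monotone block functions): e.g. `(σ₅ ∧ Φ_A(σ₁,…,σ₄), σ₅ ∧ Φ_B(σ₁,…,σ₄))` and
`(Φ_A(σ₁,…,σ₄), σ₅ ∧ Φ_B(σ₁,…,σ₄))` with a FIFTH block event `σ₅`. [this work] -/
theorem UGen.andAdj_subst_uGood {f g : Pt d → ℝ} (h : UGen d f g) (c₁ c₂ : Bool) (e : ℕ) {σ : Pt e → Bool} (hσ : Monotone σ) :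
    UGood (SahiThreeCopy.subst e σ (SahiThreeCopy.andAdj c₁ f)) (SahiThreeCopy.subst e σ (SahiThreeCopy.andAdj c₂ g)) :=
  (h.uGood.andAdj c₁ c₂).subst e hσ

end

end Summit.CriticalPhenomena.PercolationContinuityZ3.Theorems.SahiThreeCopy
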